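import Summits.CriticalPhenomena.PercolationContinuityZ3.Theorems.PercHyperscalingGluingFreeBoxShatteringRootSkeleton
import Summits.CriticalPhenomena.PercolationContinuityZ3.Theorems.PercHyperscalingGluingFreeBoxShatteringStubUniquenessGluing

/-!
# The root skeleton of critical percolation on `ℤ³`, part 2: dense free pieces need many roots
# (supports crux `PercHyperscalingGluing.FreeBoxShattering`, stmt-CriticalPhenomena-4644, line `registered`)

Part 1 (`…RootSkeleton.lean`): off the root skeleton `S_t(ω)` (sites joined inside the upward
half-space of some axis to height `+t`) open lattice clusters have coordinate extent `< t`, so a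
free piece satisfies `|K_Λ(x)| ≤ (2t+1)³(1 + #(S_t ∩ Λ))`, and each site is on `S_t` with
probability `≤ 3 P_p(A_t)`, `A_t = halfSpaceReach 3 t`. Here, the first moment:

* `real_dense_mul_le` (every `p`, finite `Λ`, `s`, `t`):
  `(s/(2t+1)³ − 1) · P_p(Λ has a free piece with ≥ s vertices) ≤ 3 |Λ| P_p(A_t)`;
* `rootSkeleton_denseBound` (registered stub; `p = p_c(ℤ³)`, `Λ = Λ_n`, `s = δ|Λ_n|`): for every
  `δ > 0` and `t`, eventually in `n`,
  `P_{p_c}(Λ_n has a δ|Λ_n|-dense free piece) ≤ (6(2t+1)³/δ) · P_{p_c}(A_t)`;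
* `freeBoxShattering_of_halfSpaceReach_cubic` — the CALIBRATION EDGE this gives for the crux:
  `(∀ ε > 0, ∃ t, (2t+1)³ P_{p_c}(A_t) ≤ ε) → FreeBoxShattering` (with the landed
  `UniquenessGluing.frequently_dense_of_not_crux`). Barsky–Grimmett–Newman give only
  `P_{p_c}(A_t) → 0`; the believed truth `P_{p_c}(A_t) ≈ t^{-0.975}` makes the hypothesis false, so
  this is a statement of what a purely boundary-rooted (BGN-type) route would need — cubic decay of
  the half-space one-arm — not a door (twin census `Cruxes/FreeBoxSparse/STRATEGY-CENSUS.md` N3(a),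
  §4.2; now kernel-checked).

Def-free (local notation). Refs: Grimmett, *Percolation* (1999) Thm (7.35); Cerf–Dembin (2020) §2.
-/

noncomputable section

namespace Summit.CriticalPhenomena.PercolationContinuityZ3.Theorems.FreeBoxShattering

open MeasureTheory Filter
open Literature.Probability.Percolation Literature.Probability.LatticeModels
open Literature.Probability.Percolation.CerfDembinVanishing (halfSpaceReach)
open scoped Topology Classical
open Summit.CriticalPhenomena.PercolationContinuityZ3.Theses.PercHyperscalingGluing (FreeBoxShattering)
open Summit.CriticalPhenomena.PercolationContinuityZ3.Theorems.FreeBoxSparse.StubBoost (measurableSet_dense)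

/-! ### Local notation (no definitions; as in part 1) -/

local notation3 "Hup⟦" i ", " x "⟧" => {z : Site 3 | (x : Site 3) (i : Fin 3) ≤ z i}
local notation3 "armUp⟦" i ", " t ", " ω ", " x "⟧" =>
  (∃ y ∈ openClusterIn (withinGraph (zdGraph 3) Hup⟦i, x⟧) (ω : BondConfig (Site 3)) (x : Site 3),
    (x : Site 3) (i : Fin 3) + ((t : ℕ) : ℤ) ≤ y i)
local notation3 "skel⟦" t ", " ω ", " x "⟧" => (∃ i : Fin 3, armUp⟦i, t, ω, x⟧)
local notation3 "piece⟦" Λ ", " ω ", " x "⟧" =>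
  ((Finset.filter (fun v => (ω : BondConfig (Site 3)) ∈
    openConnIn (↑(Λ : Finset (Site 3)) : Set (Site 3)) x v) Λ).card : ℝ)
local notation3 "dense⟦" Λ ", " θ "⟧" =>
  {ω : BondConfig (Site 3) | ∃ x ∈ (Λ : Finset (Site 3)), (θ : ℝ) ≤ piece⟦Λ, ω, x⟧}
local notation3 "μc" => bondPercolation (zdGraph 3) (criticalProbI 3)

namespace RootSkeleton

/-- `{ω | ω ⊆ E}` is measurable (countably many pairs; cf. the tree's
`measurableSet_setOf_subset_right` of `LatticeModels/SiteBurtonKeane.lean`). [folklore] -/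
theorem measurableSet_setOf_subset_right' (E : Set (Sym2 (Site 3))) :
    MeasurableSet {ω : BondConfig (Site 3) | ω ⊆ E} := by
  have h : {ω : BondConfig (Site 3) | ω ⊆ E} = ⋂ e ∈ Eᶜ, {ω | e ∈ ω}ᶜ := by
    ext ω
    simp only [Set.mem_setOf_eq, Set.mem_iInter, Set.mem_compl_iff]
    exact ⟨fun h e he heω => he (h heω), fun h e heω => by_contra fun he => h e he heω⟩
  rw [h]
  exact MeasurableSet.biInter (Set.to_countable _) fun e _ => (measurableSet_mem e).compl

/-- **Pointwise root count.** On a lattice configuration, if some free piece of `Λ` has `≥ s`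
vertices then `Λ` carries at least `s/(2t+1)³ − 1` skeleton sites (`card_piece_le'`). [folklore] -/
theorem sub_one_le_card_skel {ω : BondConfig (Site 3)} (hω : ω ⊆ (zdGraph 3).edgeSet)
    {Λ : Finset (Site 3)} {s : ℝ} (t : ℕ) (hs : ω ∈ dense⟦Λ, s⟧) :
    s / (2 * (t : ℝ) + 1) ^ 3 - 1 ≤ ((Λ.filter fun u => skel⟦t, ω, u⟧).card : ℝ) := by
  obtain ⟨x, -, hx⟩ := hs
  have h := hx.trans (card_piece_le' hω t Λ x)
  have ht : (0 : ℝ) < (2 * (t : ℝ) + 1) ^ 3 := by positivity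
  rw [sub_le_iff_le_add, div_le_iff₀ ht]
  linarith

/-- **First moment** (every `p`, finite `Λ`, `s`, `t`):
`(s/(2t+1)³ − 1) · P_p(some free piece of Λ has ≥ s vertices) ≤ 3 |Λ| P_p(A_t)` — integrate the
pointwise root count over lattice configurations (an almost sure event) and use
`P_p(x ∈ S_t) ≤ 3 P_p(A_t)` (`real_skel_le`). [folklore] -/
theorem real_dense_mul_le (p : unitInterval) (Λ : Finset (Site 3)) (s : ℝ) (t : ℕ) :
    (s / (2 * (t : ℝ) + 1) ^ 3 - 1) * (bondPercolation (zdGraph 3) p).real dense⟦Λ, s⟧ ≤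
      3 * (Λ.card : ℝ) * (bondPercolation (zdGraph 3) p).real (halfSpaceReach 3 t) := by
  classical
  set μ := bondPercolation (zdGraph 3) p with hμ
  set c : ℝ := s / (2 * (t : ℝ) + 1) ^ 3 - 1 with hc
  have hRHS : 0 ≤ 3 * (Λ.card : ℝ) * μ.real (halfSpaceReach 3 t) := by positivity
  by_cases hcpos : c ≤ 0
  · exact (mul_nonpos_of_nonpos_of_nonneg hcpos measureReal_nonneg).trans hRHS
  push Not at hcpos
  -- lattice configurations: an almost sure event
  set L : Set (BondConfig (Site 3)) := {ω | ω ⊆ (zdGraph 3).edgeSet} with hL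
  have hLm : MeasurableSet L := measurableSet_setOf_subset_right' _
  have hae : ∀ᵐ ω ∂μ, ω ∈ L := ProbabilityTheory.setBernoulli_ae_subset
  have hE : μ.real dense⟦Λ, s⟧ = μ.real (dense⟦Λ, s⟧ ∩ L) :=
    measureReal_congr (by
      have : (L : Set (BondConfig (Site 3))) =ᵐ[μ] (Set.univ : Set (BondConfig (Site 3))) :=
        ae_eq_univ.2 (ae_iff.1 hae)
      simpa using ((ae_eq_refl (dense⟦Λ, s⟧ : Set (BondConfig (Site 3)))).inter this).symm)
  have hEm : MeasurableSet (dense⟦Λ, s⟧ ∩ L) := (measurableSet_dense Λ s).inter hLm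
  -- the count of skeleton sites as a sum of indicators
  set R : Site 3 → Set (BondConfig (Site 3)) := fun u => {ω | skel⟦t, ω, u⟧} with hR
  have hRm : ∀ u, MeasurableSet (R u) := fun u => measurableSet_skel t u
  set g : BondConfig (Site 3) → ℝ := fun ω => ∑ u ∈ Λ, (R u).indicator (1 : BondConfig (Site 3) → ℝ) ω
    with hg
  have hint : ∀ u, Integrable (fun ω => (R u).indicator (1 : BondConfig (Site 3) → ℝ) ω) μ :=
    fun u => (integrable_const (1 : ℝ)).indicator (hRm u)
  have hgint : Integrable g μ := integrable_finsetSum _ fun u _ => hint u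
  have hg_eq : ∀ ω, g ω = ((Λ.filter fun u => skel⟦t, ω, u⟧).card : ℝ) := by
    intro ω
    rw [hg, Finset.card_filter, Nat.cast_sum]
    refine Finset.sum_congr rfl fun u _ => ?_
    by_cases h : skel⟦t, ω, u⟧
    · rw [Set.indicator_of_mem (show ω ∈ R u from h), if_pos h]; simp
    · rw [Set.indicator_of_notMem (show ω ∉ R u from h), if_neg h]; simp
  -- `c · P(E ∩ L) ≤ ∫_{E ∩ L} g ≤ ∫ g = Σ_u P(u ∈ S_t) ≤ 3 |Λ| P(A_t)`
  have hlow : ∀ ω ∈ dense⟦Λ, s⟧ ∩ L, c ≤ g ω := by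
    rintro ω ⟨hω, hωL⟩
    rw [hg_eq]
    exact sub_one_le_card_skel hωL t hω
  have hstep1 : c * μ.real (dense⟦Λ, s⟧ ∩ L) ≤ ∫ ω in dense⟦Λ, s⟧ ∩ L, g ω ∂μ :=
    setIntegral_ge_of_const_le_real hEm (measure_ne_top _ _) hlow hgint.integrableOn
  have hstep2 : ∫ ω in dense⟦Λ, s⟧ ∩ L, g ω ∂μ ≤ ∫ ω, g ω ∂μ :=
    setIntegral_le_integral hgint (Eventually.of_forall fun ω =>
      Finset.sum_nonneg fun u _ => Set.indicator_nonneg (fun _ _ => zero_le_one) _)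
  have hstep3 : ∫ ω, g ω ∂μ = ∑ u ∈ Λ, μ.real (R u) := by
    rw [hg, integral_finsetSum _ fun u _ => hint u]
    exact Finset.sum_congr rfl fun u _ => integral_indicator_one (hRm u)
  have hstep4 : ∀ u ∈ Λ, μ.real (R u) ≤ 3 * μ.real (halfSpaceReach 3 t) := fun u _ =>
    real_skel_le p t u
  rw [hE]
  calc c * μ.real (dense⟦Λ, s⟧ ∩ L) ≤ ∫ ω, g ω ∂μ := hstep1.trans hstep2
    _ = ∑ u ∈ Λ, μ.real (R u) := hstep3
    _ ≤ ∑ _u ∈ Λ, 3 * μ.real (halfSpaceReach 3 t) := Finset.sum_le_sum hstep4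
    _ = 3 * (Λ.card : ℝ) * μ.real (halfSpaceReach 3 t) := by
        rw [Finset.sum_const, nsmul_eq_mul]; ring

/-- `|Λ_n| → ∞`. [folklore] -/
theorem tendsto_card_box_atTop : Tendsto (fun n : ℕ => ((box 3 n).card : ℝ)) atTop atTop := by
  have h : ∀ n : ℕ, (n : ℝ) ≤ ((box 3 n).card : ℝ) := fun n => by
    have hn : (0 : ℝ) ≤ n := Nat.cast_nonneg n
    rw [card_box]; push_cast; nlinarith [hn, sq_nonneg (n : ℝ)]
  exact tendsto_atTop_mono h tendsto_natCast_atTop_atTop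

/-- **Dense free pieces at `p_c` versus the half-space one-arm** (`p = p_c(ℤ³)`, `Λ = Λ_n`,
`s = δ|Λ_n|`): for every `δ > 0` and `t`, eventually in `n`,
`P_{p_c}(Λ_n has a δ|Λ_n|-dense free piece) ≤ (6(2t+1)³/δ) · P_{p_c}(A_t)`. (Every `p` would do;
stated at `p_c`, where `P(A_t) → 0` by Barsky–Grimmett–Newman.) [folklore] -/
theorem real_dense_box_le {δ : ℝ} (hδ : 0 < δ) (t : ℕ) : ∀ᶠ n : ℕ in atTop,
    (μc).real dense⟦box 3 n, δ * ((box 3 n).card : ℝ)⟧ ≤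
      6 * (2 * (t : ℝ) + 1) ^ 3 / δ * (μc).real (halfSpaceReach 3 t) := by
  have ht : (0 : ℝ) < (2 * (t : ℝ) + 1) ^ 3 := by positivity
  have hev : ∀ᶠ n : ℕ in atTop, 2 * (2 * (t : ℝ) + 1) ^ 3 / δ ≤ ((box 3 n).card : ℝ) :=
    tendsto_card_box_atTop.eventually_ge_atTop _
  filter_upwards [hev] with n hn
  set V : ℝ := ((box 3 n).card : ℝ) with hV
  set h : ℝ := (μc).real (halfSpaceReach 3 t) with hh
  have hV0 : 0 < V := by
    have : (0 : ℝ) < 2 * (2 * (t : ℝ) + 1) ^ 3 / δ := by positivity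
    linarith
  have hmain := real_dense_mul_le (criticalProbI 3) (box 3 n) (δ * V) t
  -- the coefficient `c = δV/(2t+1)³ − 1 ≥ δV/(2(2t+1)³) > 0`
  set c : ℝ := δ * V / (2 * (t : ℝ) + 1) ^ 3 - 1 with hc
  have hδV : 2 * (2 * (t : ℝ) + 1) ^ 3 ≤ δ * V := by
    have := (div_le_iff₀ hδ).1 hn; linarith
  have hc_ge : δ * V / (2 * (2 * (t : ℝ) + 1) ^ 3) ≤ c := by
    rw [hc, div_le_iff₀ (by positivity)]
    have h1 : δ * V / (2 * (t : ℝ) + 1) ^ 3 * (2 * (2 * (t : ℝ) + 1) ^ 3) = 2 * (δ * V) := by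
      field_simp
    nlinarith [h1]
  have hcpos : 0 < c := lt_of_lt_of_le (by positivity) hc_ge
  have hP0 : 0 ≤ (μc).real dense⟦box 3 n, δ * V⟧ := measureReal_nonneg
  have hh0 : 0 ≤ h := measureReal_nonneg
  -- `P ≤ 3 V h / c ≤ 3 V h · 2(2t+1)³/(δ V) = 6 (2t+1)³ h / δ`
  have h1 : (μc).real dense⟦box 3 n, δ * V⟧ ≤ 3 * V * h / c := by
    rw [le_div_iff₀ hcpos]; linarith [hmain]
  have h2 : 3 * V * h / c ≤ 3 * V * h / (δ * V / (2 * (2 * (t : ℝ) + 1) ^ 3)) :=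
    div_le_div_of_nonneg_left (by positivity) (by positivity) hc_ge
  have h3 : 3 * V * h / (δ * V / (2 * (2 * (t : ℝ) + 1) ^ 3)) =
      6 * (2 * (t : ℝ) + 1) ^ 3 / δ * h := by
    field_simp
    ring
  linarith [h1, h2, h3.le]

end RootSkeleton

/-- **Registered stub `rootSkeleton_denseBound`** (`p = p_c(ℤ³)`): for every `δ > 0` and `t ∈ ℕ`,
eventually in `n`, the probability that the free box `Λ_n` has a free piece with `≥ δ|Λ_n|`
vertices is at most `(6(2t+1)³/δ) · P_{p_c}(A_t)`, `A_t = halfSpaceReach 3 t` the event that the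
origin is joined inside the half-space `ℍ` to height `≥ t`. [cite: BarskyGrimmettNewman1991, Thm 1.1] -/
theorem rootSkeleton_denseBound : ∀ δ : ℝ, 0 < δ → ∀ t : ℕ, ∀ᶠ n : ℕ in atTop,
    (bondPercolation (zdGraph 3) (criticalProbI 3)).real
        {ω : BondConfig (Site 3) | ∃ x ∈ box 3 n, δ * ((box 3 n).card : ℝ) ≤
          (((box 3 n).filter fun v => ω ∈ openConnIn (↑(box 3 n) : Set (Site 3)) x v).card : ℝ)} ≤
      6 * (2 * (t : ℝ) + 1) ^ 3 / δ *
        (bondPercolation (zdGraph 3) (criticalProbI 3)).real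
          (Literature.Probability.Percolation.CerfDembinVanishing.halfSpaceReach 3 t) :=
  fun _ hδ t => RootSkeleton.real_dense_box_le hδ t

/-- **Calibration edge (kernel-checked census entry N3(a)): cubic decay of the critical half-space
one-arm along a subsequence would give the crux.** If for every `ε > 0` some `t` has
`(2t+1)³ P_{p_c}(A_t) ≤ ε`, then `FreeBoxShattering` holds: otherwise
(`UniquenessGluing.frequently_dense_of_not_crux`) some density `δ` is carried with probability
`≥ 1/2` at infinitely many scales, against `rootSkeleton_denseBound` with `ε = δ/24`.
Barsky–Grimmett–Newman give `P_{p_c}(A_t) → 0` only; the believed value `≈ t^{-0.975}` makes the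
hypothesis FALSE — this records what a BGN-type route would need, it is not a door. [folklore] -/
theorem freeBoxShattering_of_halfSpaceReach_cubic
    (hcubic : ∀ ε : ℝ, 0 < ε → ∃ t : ℕ, (2 * (t : ℝ) + 1) ^ 3 *
      (bondPercolation (zdGraph 3) (criticalProbI 3)).real
        (Literature.Probability.Percolation.CerfDembinVanishing.halfSpaceReach 3 t) ≤ ε) :
    FreeBoxShattering := by
  by_contra hS
  obtain ⟨δ, hδ, hfreq⟩ := UniquenessGluing.frequently_dense_of_not_crux hS (by norm_num : (0 : ℝ) < 1 / 2)
  obtain ⟨t, ht⟩ := hcubic (δ / 24) (by positivity)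
  have hev := RootSkeleton.real_dense_box_le hδ t
  have hbound : 6 * (2 * (t : ℝ) + 1) ^ 3 / δ *
      (μc).real (halfSpaceReach 3 t) ≤ 1 / 4 := by
    rw [div_mul_eq_mul_div, div_le_iff₀ hδ]
    nlinarith [ht]
  obtain ⟨n, hn1, hn2⟩ := (hfreq.and_eventually hev).exists
  linarith

end Summit.CriticalPhenomena.PercolationContinuityZ3.Theorems.FreeBoxShattering

end
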